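/-
Copyright (c) 2026 the pub-hodgecm-mathlib formalisation cell (harness21).  Prover seat hodgecm-mathlib-K2Liu-p11 (g5), Track B «K2-LIT»,
#184♮ = hLiu418 = `stmt-HodgeConjecture-24832`; socket #41 `sig_K2LiuSiegelEisensteinContinuation`, KIND W, brick (iii-arch-int): the ARCHIMEDEAN INTEGRABILITY
letter `hintArch` of F0P2-p08's (x-a-int) `K2LiuKindWJointIntegrable.hint_of_factorIntegrable` (the archimedean factor of ★ (x-a) ED. 4's joint integrability letter
`hint`), for archimedean factors PRESENTED as flat products over the complex places in the frame of record — LEAD F0P6-plan (g14) BATCH #178 (2); desk F0P2-p08 (g3);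
box K2Liu-audit1 (g2).  THEOREMS ONLY (no `def`, no `instance`, no notation, no named-fact hypothesis, no `sorry`, default heartbeats).
-/
import Summits.HodgeConjecture.HodgeConjecture.Theorems.K2LiuKindWArchContinuation          -- ★ FILE A (LH4-p10): §5 `integrable_twisted_prod_unipDeltaArch_of_record`, the frame letters, `unipDeltaArch`
import Summits.HodgeConjecture.HodgeConjecture.Theorems.K2LiuSiegelUnipotentCharacters      -- ★ `continuous_unipDeltaChar` (`ψ_S` is continuous on `H(𝔸)`)
import Summits.HodgeConjecture.HodgeConjecture.Theorems.K2LiuSiegelEisensteinKindWLetters   -- ★ (x-a) ED. 1–2: `kindWFinset` (the KIND-W place set `T(S,h)` indexing `νinf`)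
import HarnessLib

/-!
# Crux `HLiu418`, socket #41, KIND W — brick (iii-arch-int) `K2LiuKindWArchLetterIntegrable`: THE ARCHIMEDEAN INTEGRABILITY LETTER `hintArch` ON `{2∕2 < re s}`
# `a ↦ conj ψ_S(ι_∞ a) · FinfT j S h s ((w_Δ)_∞ · a · h_∞)` is `ν_∞`-integrable on `N_Δ(L⁺ ⊗ ℝ)` for an archimedean factor PRESENTED AS A FLAT PRODUCT in the frame of record

Cell `hodgecm-mathlib`, crux item hLiu418 = `stmt-HodgeConjecture-24832` (helper lane `--supports … --as helper`, count-neutral), route of record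
`HCCMUnconditional`; squad K2 ∕ K2Liu, road `K2_Liu`, socket #41, KIND W; KW desk of record F0P2-p08 (g3).  THE LETTER PAID: the archimedean input `hintArch` of
F0P2-p08's (x-a-int) `K2LiuKindWJointIntegrable.hint_of_factorIntegrable` — ★ (x-a) ED. 4 `K2LiuSiegelEisensteinKindWEulerLocalLetters.exists_kindW_eulerLetters_of_localLetters`
takes the JOINT integrability `hint` of each pure summand of the `T`-part on `N_Δ(L⁺⊗ℝ) × Π_{v∈T} N_Δ(L⁺_v)`; (x-a-int) splits it (`Integrable.prod_mul`) into the per-place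
finite letters (★ (iii-fin-int) `K2LiuKindWFiniteLetterIntegrable.hint_of_isLocalSiegelSection`, the finite twin of this file) and the ARCHIMEDEAN letter, per term `j`, per
non-singular skew index `S`, per `h`, on `{2∕2 < re s}`:
  `Integrable (a ↦ conj ψ_S(ι_∞ a) · FinfT j S h s ((w_Δ)_∞ · a · h_∞)) (νinf (kindWFinset T₀ ↑S h))`
(the integrand of ★ ED. 4's `hFinfI` ∕ ★ `K2LiuKindWArchLetterDefs.archWhittakerIntegral`, as a function of `a`).
THE POINT.  No definite∕indefinite split of the index is needed for INTEGRABILITY (only for the continuation `hex`): the character `conj ψ_S(ι_∞ ·)` is unimodular and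
continuous (★ `continuous_unipDeltaChar` ∘ ★ `UnitaryGroup.continuous_archToAdelic`, `Circle.norm_coe`), and once the archimedean factor `FinfT j S h s : H_∞ → ℂ` is PRESENTED
as a flat product over the complex places in the frame of record — `FinfT j S h s a = ∏_w F_w(Fr a w)` with `F_w ∈ I_w(s, χ_{k_w})` flat of compact picture `Q_w` (the currency
of ★ `K2LiuArchFlatTubePresentation` and of ★ FILE A §4's `hpres hFs hFsQ`, i.e. the SAME letters that pay the continuation letter `hex`) — the integrability on the bigger
half-plane `{½ < re s}` is ★ FILE A §5 `K2LiuKindWArchContinuation.integrable_twisted_prod_unipDeltaArch_of_record` (★ (E8) END `integrable_prod_unipDeltaArch_of_record`: the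
unweighted flat product is `ν_∞`-integrable by the Γ₂ ∕ Siegel–Gindikin majorant on `Herm₂(ℂ)⁺`, times a weight of norm `≤ 1`, Mathlib `Integrable.bdd_mul`).
* §1 **`integrable_conj_unipDeltaChar_mul_of_presentation`** — one index `S`, one Haar `ν` on `N_Δ(L⁺⊗ℝ)`, one point `g ∈ H_∞`, `½ < re s`, one presented factor `Φ`.
* §2 **`hintArch_of_kindWArchLetter`** — F0P2-p08's `hintArch` slot VERBATIM at `n := 2` (datum `e : Fin N₀ × Fin M₀ ≃ Fin 2`; `2∕2 < re s`, `det ↑S ≠ 0`; carriers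
  `νinf T` Haar), from the frame letters of record BY VALUE (★ FILE A's variable block, byte-identical) and the per-`(S,h,s,j)` flat-product PRESENTATION letter (binder order = ★ ED. 4's `hint`) in its weakest
  (existential) form.
[Shimura1997, §16.4, §18.4] [KudlaRallis1994, §1–§2] [BorelJacquet1979, §4.1] [MoeglinWaldspurger1995, II.1.5].
HONEST LABEL.  Count-neutral helper; closes no socket by itself: `HC_CM` is proved only modulo the 7 printed citations (2 remaining named inputs:
hLiu418 = `stmt-HodgeConjecture-24832`, h413 = `stmt-HodgeConjecture-24833`) until rung 0 closes.  NOT HERE (by value): the flat product presentation of the (KW-fac)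
archimedean factors `FinfT j S h s` (★ `K2LiuArchFlatTubePresentation` after the (KW-fac) bookkeeping), and that the carriers `νinf T` are Haar (★ Φ3b
`exists_isHaarMeasure_map_unipDeltaSplit_eq_prod_pi_rpMeasure` proves it for the carriers of record).

## References
* [Shimura1997] G. Shimura, *Euler Products and Eisenstein Series*, CBMS 93 (1997), §16.4, §18.4 (archimedean factors of the Fourier coefficients; absolute convergence).
* [KudlaRallis1994] S. Kudla, S. Rallis, Ann. of Math. 140 (1994), §1–§2 (Euler factorisation of the Fourier coefficients of Siegel Eisenstein series).
* [BorelJacquet1979] A. Borel, H. Jacquet, Proc. Symp. Pure Math. 33 (1979), §4.1 (archimedean components).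
* [MoeglinWaldspurger1995] C. Mœglin, J.-L. Waldspurger, *Spectral Decomposition and Eisenstein Series* (1995), II.1.5 (Fourier–Whittaker coefficients).
-/

set_option autoImplicit false
set_option linter.dupNamespace false -- the mandated namespace repeats `HodgeConjecture.HodgeConjecture`

noncomputable section

open Complex Matrix MeasureTheory MeasureTheory.Measure NumberField IsDedekindDomain
open scoped ComplexConjugate NNReal
open Literature.NumberTheory.Automorphic Literature.NumberTheory.GelbartRogawski1991 Literature.NumberTheory.GelbartRogawski1991.GRConstruction
open Literature.NumberTheory.K2Lit.SiegelDoubled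
open Summit.HodgeConjecture.HodgeConjecture.Cruxes.HLiu418.K2LiuArchInducedTubeDefs
open Summit.HodgeConjecture.HodgeConjecture.Cruxes.HLiu418.K2LiuU22CompactPictureDefs
open Summit.HodgeConjecture.HodgeConjecture.Cruxes.HLiu418.K2LiuSiegelUnipotentLocalDefs (unipDeltaArch)
open Summit.HodgeConjecture.HodgeConjecture.Cruxes.HLiu418.K2LiuSiegelUnipotentFourierDefs (skewMatrices unipDeltaChar)
open Summit.HodgeConjecture.HodgeConjecture.Cruxes.HLiu418.K2LiuSiegelUnipotentCharacters (continuous_unipDeltaChar)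
open Summit.HodgeConjecture.HodgeConjecture.Cruxes.HLiu418.K2LiuSiegelEisensteinKindWLetters (kindWFinset)
open Summit.HodgeConjecture.HodgeConjecture.Cruxes.HLiu418.K2LiuKindWArchContinuation (integrable_twisted_prod_unipDeltaArch_of_record)

namespace Summit.HodgeConjecture.HodgeConjecture.Cruxes.HLiu418.K2LiuKindWArchLetterIntegrable

variable (L : Type) [Field L] [NumberField L] [IsCMField L]
variable {N₀ M₀ : ℕ} (e : Fin N₀ × Fin M₀ ≃ Fin 2)
  (dV : Fin N₀ → L) (hdV : ∀ i, IsCMField.complexConj L (dV i) = dV i)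
  (dW : Fin M₀ → L) (hdW : ∀ i, IsCMField.complexConj L (dW i) = dW i)
  (T Tinv : {w : InfinitePlace L // w.IsComplex} → Matrix (Fin 2 ⊕ Fin 2) (Fin 2 ⊕ Fin 2) ℂ)
  (Fr : UnitaryGroup.arch (Fp L) L (IsCMField.complexConj L) (2 + 2) (hermD L e dV hdV dW hdW) →
    {w : InfinitePlace L // w.IsComplex} → Matrix (Fin 2 ⊕ Fin 2) (Fin 2 ⊕ Fin 2) ℂ)
  (hFr : ∀ a w, Fr a w = T w * Matrix.reindex (e₂ (n := 2)).symm (e₂ (n := 2)).symm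
    (((UnitaryGroup.archAt (Fp L) L (IsCMField.complexConj L) (2 + 2) (hermD L e dV hdV dW hdW) w
      (UnitaryGroup.complexConj_smul_infinitePlace L w.1) (IsCMField.complexConj_ne_one L) a :
        UnitaryGroup.archLocal L (2 + 2) (hermD L e dV hdV dW hdW) w) : GL (Fin (2 + 2)) ℂ) : Matrix (Fin (2 + 2)) (Fin (2 + 2)) ℂ) * Tinv w)
  (hT2 : ∀ w, Tinv w * T w = 1)
  (hTU : ∀ w (g : GL (Fin (2 + 2)) ℂ), g ∈ UnitaryGroup.archLocal L (2 + 2) (hermD L e dV hdV dW hdW) w →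
    (T w * Matrix.reindex (e₂ (n := 2)).symm (e₂ (n := 2)).symm (g : Matrix _ _ ℂ) * Tinv w)ᴴ * Matrix.J (Fin 2) ℂ *
      (T w * Matrix.reindex (e₂ (n := 2)).symm (e₂ (n := 2)).symm (g : Matrix _ _ ℂ) * Tinv w) = Matrix.J (Fin 2) ℂ)
  [MeasurableSpace ↥(unipDeltaArch L e dV hdV dW hdW)] [BorelSpace ↥(unipDeltaArch L e dV hdV dW hdW)]
  [Fintype {w : InfinitePlace L // w.IsComplex}]

/-! ## §1 One index, one Haar carrier, one point, one presented archimedean factor -/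

include hFr hT2 hTU in
/-- **`a ↦ conj ψ_S(ι_∞ a) · Φ((w_Δ)_∞ · a · g)` IS INTEGRABLE ON `N_Δ(L⁺ ⊗ ℝ)`** for `½ < re s` and an archimedean factor `Φ : H_∞ → ℂ` PRESENTED as a flat product over the
complex places in the frame of record, `Φ a = ∏_w F_w(Fr a w)` with `F_w ∈ I_w(s, χ_{k_w})` flat of compact picture `Q_w` — ★ FILE A §5 `integrable_twisted_prod_unipDeltaArch_of_record`
with the weight `Wt a := conj ψ_S(ι_∞ a)` (continuous: ★ `continuous_unipDeltaChar` ∘ ★ `continuous_archToAdelic`; unimodular: `Circle.norm_coe`), then `Integrable.congr` along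
the presentation.  Inputs BY VALUE: the frame letters of record `(T, Tinv, Fr, hFr, hT1, hT2, hTU, hTiv, hTN)`, the anti-diagonal reading `hBC`, a Haar `ν` on `N_Δ(L⁺⊗ℝ)`.
[cite: Shimura1997, §16.4] [cite: KudlaRallis1994, §1–§2] [cite: BorelJacquet1979, §4.1] -/
theorem integrable_conj_unipDeltaChar_mul_of_presentation (hT1 : ∀ w, T w * Tinv w = 1)
    (hTiv : ∀ w (u : GL (Fin (2 + 2)) ℂ), u ∈ UnitaryGroup.archLocal L (2 + 2) (hermD L e dV hdV dW hdW) w →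
      K2LiuSiegelUnipotentLocalDefs.IsUnipM (n := 2) (u : Matrix (Fin (2 + 2)) (Fin (2 + 2)) ℂ) →
        ∃ b : Matrix (Fin 2) (Fin 2) ℂ, bᴴ = b ∧ T w * Matrix.reindex (e₂ (n := 2)).symm (e₂ (n := 2)).symm (u : Matrix _ _ ℂ) * Tinv w = fromBlocks 1 b 0 1)
    (hTN : ∀ w (b : Matrix (Fin 2) (Fin 2) ℂ), bᴴ = b → ∃ u : GL (Fin (2 + 2)) ℂ,
      u ∈ UnitaryGroup.archLocal L (2 + 2) (hermD L e dV hdV dW hdW) w ∧ K2LiuSiegelUnipotentLocalDefs.IsUnipM (n := 2) (u : Matrix (Fin (2 + 2)) (Fin (2 + 2)) ℂ) ∧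
        T w * Matrix.reindex (e₂ (n := 2)).symm (e₂ (n := 2)).symm (u : Matrix _ _ ℂ) * Tinv w = fromBlocks 1 b 0 1)
    (ν : Measure ↥(unipDeltaArch L e dV hdV dW hdW)) [ν.IsHaarMeasure]
    (B C : {w : InfinitePlace L // w.IsComplex} → Matrix (Fin 2) (Fin 2) ℂ) (hBC : ∀ w, T w * fromBlocks 1 0 0 (-1) * Tinv w = fromBlocks 0 (B w) (C w) 0)
    (k : {w : InfinitePlace L // w.IsComplex} → ℤ) (Q : {w : InfinitePlace L // w.IsComplex} → Carrier)
    (g : UnitaryGroup.arch (Fp L) L (IsCMField.complexConj L) (2 + 2) (hermD L e dV hdV dW hdW))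
    (S : Matrix (Fin 2) (Fin 2) L) {s : ℂ} (hs : 1 / 2 < s.re)
    (Fs : {w : InfinitePlace L // w.IsComplex} → Matrix (Fin 2 ⊕ Fin 2) (Fin 2 ⊕ Fin 2) ℂ → ℂ)
    (hFs : ∀ w, IsArchSiegelSection (fun z : ℂ => (conj z / ((‖z‖ : ℝ) : ℂ)) ^ (k w)) s (Fs w))
    (hFsQ : ∀ w, ∀ (v : Matrix (Fin 2) (Fin 2) ℂ), vᴴ * v = 1 → ∀ hv : v.det ≠ 0,
      (Fs w) ((2 : ℂ)⁻¹ • fromBlocks (1 + v) (-(I • (1 - v))) (I • (1 - v)) (1 + v) : Matrix (Fin 2 ⊕ Fin 2) (Fin 2 ⊕ Fin 2) ℂ) = evalAt v hv (Q w))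
    (Φ : UnitaryGroup.arch (Fp L) L (IsCMField.complexConj L) (2 + 2) (hermD L e dV hdV dW hdW) → ℂ)
    (hpres : ∀ a : UnitaryGroup.arch (Fp L) L (IsCMField.complexConj L) (2 + 2) (hermD L e dV hdV dW hdW), Φ a = ∏ w, Fs w (Fr a w)) :
    Integrable (fun a : ↥(unipDeltaArch L e dV hdV dW hdW) =>
      conj (unipDeltaChar L e dV hdV dW hdW S
          (UnitaryGroup.archToAdelic (Fp L) L (IsCMField.complexConj L) (2 + 2) (hermD L e dV hdV dW hdW)
            (a : UnitaryGroup.arch (Fp L) L (IsCMField.complexConj L) (2 + 2) (hermD L e dV hdV dW hdW))) : ℂ) *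
        Φ (UnitaryGroup.archPart (Fp L) L (IsCMField.complexConj L) (2 + 2) (hermD L e dV hdV dW hdW) (weylDelta L e dV hdV dW hdW) *
            (a : UnitaryGroup.arch (Fp L) L (IsCMField.complexConj L) (2 + 2) (hermD L e dV hdV dW hdW)) * g)) ν := by
  -- the unimodular continuous weight `Wt a := conj ψ_S(ι_∞ a)`
  have hWtm : AEStronglyMeasurable (fun a : ↥(unipDeltaArch L e dV hdV dW hdW) =>
      conj (unipDeltaChar L e dV hdV dW hdW S
          (UnitaryGroup.archToAdelic (Fp L) L (IsCMField.complexConj L) (2 + 2) (hermD L e dV hdV dW hdW)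
            (a : UnitaryGroup.arch (Fp L) L (IsCMField.complexConj L) (2 + 2) (hermD L e dV hdV dW hdW))) : ℂ)) ν := by
    refine Continuous.aestronglyMeasurable ?_
    exact Complex.continuous_conj.comp ((continuous_unipDeltaChar L e dV hdV dW hdW S).comp
      ((UnitaryGroup.continuous_archToAdelic (Fp L) L (IsCMField.complexConj L) (2 + 2) (hermD L e dV hdV dW hdW)).comp continuous_subtype_val))
  have hWt1 : ∀ a : ↥(unipDeltaArch L e dV hdV dW hdW),
      ‖(conj (unipDeltaChar L e dV hdV dW hdW S
          (UnitaryGroup.archToAdelic (Fp L) L (IsCMField.complexConj L) (2 + 2) (hermD L e dV hdV dW hdW)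
            (a : UnitaryGroup.arch (Fp L) L (IsCMField.complexConj L) (2 + 2) (hermD L e dV hdV dW hdW))) : ℂ))‖ ≤ 1 := fun a => by
    rw [Complex.norm_conj]
    exact (Circle.norm_coe _).le
  -- ★ FILE A §5 for the flat family `Fs`, then the presentation
  have hI := integrable_twisted_prod_unipDeltaArch_of_record L e dV hdV dW hdW T Tinv Fr hFr hT2 hTU hT1 hTiv hTN ν B C hBC k Q g _ hWtm hWt1 hs Fs hFs hFsQ
  exact hI.congr (Filter.Eventually.of_forall fun a => by simp only [hpres])

/-! ## §2 The letter `hintArch` of (x-a-int) `hint_of_factorIntegrable`, verbatim -/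

include hFr hT2 hTU in
/-- **THE ARCHIMEDEAN LETTER `hintArch` OF (x-a-int) `K2LiuKindWJointIntegrable.hint_of_factorIntegrable` AT `n := 2`, PAID FOR PRESENTED ARCHIMEDEAN FACTORS.**  Inputs: the bad
set `T₀` and the archimedean carriers `νinf T` (Haar — ★ Φ3b for the carriers of record); the frame letters of record `(T, Tinv, Fr, hFr, hT1, hT2, hTU, hTiv, hTN)` and the
anti-diagonal reading `hBC` (★ `K2LiuHolTubeRigidityOfFrame` §2 ∕ ★ `exists_tubeFrame_arch₃`), BY VALUE; the archimedean factors `FinfT j S h s` of the Σ⊗ presentation of the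
`T`-part (by value, (KW-fac)) with, per `(S, h, s, j)` on `{2∕2 < re s}`, `det ↑S ≠ 0`, the PRESENTATION letter in its weakest form — there EXIST weights `k_w`, compact pictures
`Q_w` and a flat family `F_w ∈ I_w(s, χ_{k_w})` with `cp F_w = Q_w` and `FinfT j S h s a = ∏_w F_w(Fr a w)` (★ `K2LiuArchFlatTubePresentation`'s currency; the same letters pay ★
FILE A §4's `hex`).  THEN the `hintArch` slot VERBATIM (binder order `S h s j` = ★ ED. 4's :108): for all `S h s j`, `2∕2 < re s → det ↑S ≠ 0 →` the integrand of ★ ED. 4's `hFinfI` is `νinf (kindWFinset T₀ ↑S h)`-integrable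
(§1 at `g := h_∞`, `½ < 1 < re s`). [cite: Shimura1997, §16.4, §18.4] [cite: KudlaRallis1994, §1–§2] [cite: MoeglinWaldspurger1995, II.1.5] -/
theorem hintArch_of_kindWArchLetter (hT1 : ∀ w, T w * Tinv w = 1)
    (hTiv : ∀ w (u : GL (Fin (2 + 2)) ℂ), u ∈ UnitaryGroup.archLocal L (2 + 2) (hermD L e dV hdV dW hdW) w →
      K2LiuSiegelUnipotentLocalDefs.IsUnipM (n := 2) (u : Matrix (Fin (2 + 2)) (Fin (2 + 2)) ℂ) →
        ∃ b : Matrix (Fin 2) (Fin 2) ℂ, bᴴ = b ∧ T w * Matrix.reindex (e₂ (n := 2)).symm (e₂ (n := 2)).symm (u : Matrix _ _ ℂ) * Tinv w = fromBlocks 1 b 0 1)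
    (hTN : ∀ w (b : Matrix (Fin 2) (Fin 2) ℂ), bᴴ = b → ∃ u : GL (Fin (2 + 2)) ℂ,
      u ∈ UnitaryGroup.archLocal L (2 + 2) (hermD L e dV hdV dW hdW) w ∧ K2LiuSiegelUnipotentLocalDefs.IsUnipM (n := 2) (u : Matrix (Fin (2 + 2)) (Fin (2 + 2)) ℂ) ∧
        T w * Matrix.reindex (e₂ (n := 2)).symm (e₂ (n := 2)).symm (u : Matrix _ _ ℂ) * Tinv w = fromBlocks 1 b 0 1)
    (B C : {w : InfinitePlace L // w.IsComplex} → Matrix (Fin 2) (Fin 2) ℂ) (hBC : ∀ w, T w * fromBlocks 1 0 0 (-1) * Tinv w = fromBlocks 0 (B w) (C w) 0)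
    (T₀ : Finset (HeightOneSpectrum (𝓞 (Fp L))))
    (νinf : Finset (HeightOneSpectrum (𝓞 (Fp L))) → Measure ↥(unipDeltaArch L e dV hdV dW hdW)) [∀ T' : Finset (HeightOneSpectrum (𝓞 (Fp L))), (νinf T').IsHaarMeasure]
    {m : ℕ}
    (FinfT : Fin m → skewMatrices ((IsCMField.complexConj L : L ≃ₐ[Fp L] L) : L →+* L) ((gramR L e dV hdV dW hdW).map (algebraMap (Fp L) L)) →
      HA L e dV hdV dW hdW → ℂ → UnitaryGroup.arch (Fp L) L (IsCMField.complexConj L) (2 + 2) (hermD L e dV hdV dW hdW) → ℂ)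
    (hpres : ∀ (S : skewMatrices ((IsCMField.complexConj L : L ≃ₐ[Fp L] L) : L →+* L) ((gramR L e dV hdV dW hdW).map (algebraMap (Fp L) L))) (h : HA L e dV hdV dW hdW)
      (s : ℂ) (j : Fin m), ((2 : ℕ) : ℝ) / 2 < s.re → (S : Matrix (Fin 2) (Fin 2) L).det ≠ 0 →
      ∃ (k : {w : InfinitePlace L // w.IsComplex} → ℤ) (Q : {w : InfinitePlace L // w.IsComplex} → Carrier)
        (Fs : {w : InfinitePlace L // w.IsComplex} → Matrix (Fin 2 ⊕ Fin 2) (Fin 2 ⊕ Fin 2) ℂ → ℂ),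
        (∀ w, IsArchSiegelSection (fun z : ℂ => (conj z / ((‖z‖ : ℝ) : ℂ)) ^ (k w)) s (Fs w)) ∧
        (∀ w, ∀ (v : Matrix (Fin 2) (Fin 2) ℂ), vᴴ * v = 1 → ∀ hv : v.det ≠ 0,
          (Fs w) ((2 : ℂ)⁻¹ • fromBlocks (1 + v) (-(I • (1 - v))) (I • (1 - v)) (1 + v) : Matrix (Fin 2 ⊕ Fin 2) (Fin 2 ⊕ Fin 2) ℂ) = evalAt v hv (Q w)) ∧
        ∀ a : UnitaryGroup.arch (Fp L) L (IsCMField.complexConj L) (2 + 2) (hermD L e dV hdV dW hdW), FinfT j S h s a = ∏ w, Fs w (Fr a w)) :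
    ∀ (S : skewMatrices ((IsCMField.complexConj L : L ≃ₐ[Fp L] L) : L →+* L) ((gramR L e dV hdV dW hdW).map (algebraMap (Fp L) L))) (h : HA L e dV hdV dW hdW)
      (s : ℂ) (j : Fin m), ((2 : ℕ) : ℝ) / 2 < s.re → (S : Matrix (Fin 2) (Fin 2) L).det ≠ 0 →
      Integrable (fun a : ↥(unipDeltaArch L e dV hdV dW hdW) =>
        conj (unipDeltaChar L e dV hdV dW hdW (S : Matrix (Fin 2) (Fin 2) L)
            (UnitaryGroup.archToAdelic (Fp L) L (IsCMField.complexConj L) (2 + 2) (hermD L e dV hdV dW hdW)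
              (a : UnitaryGroup.arch (Fp L) L (IsCMField.complexConj L) (2 + 2) (hermD L e dV hdV dW hdW))) : ℂ) *
          FinfT j S h s (UnitaryGroup.archPart (Fp L) L (IsCMField.complexConj L) (2 + 2) (hermD L e dV hdV dW hdW) (weylDelta L e dV hdV dW hdW) *
              (a : UnitaryGroup.arch (Fp L) L (IsCMField.complexConj L) (2 + 2) (hermD L e dV hdV dW hdW)) *
              UnitaryGroup.archPart (Fp L) L (IsCMField.complexConj L) (2 + 2) (hermD L e dV hdV dW hdW) h))
        (νinf (kindWFinset L e dV hdV dW hdW T₀ (S : Matrix (Fin 2) (Fin 2) L) h)) := by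
  intro S h s j hs hdet
  have hs' : 1 / 2 < s.re := by norm_num at hs; linarith
  obtain ⟨k, Q, Fs, hFs, hFsQ, hpr⟩ := hpres S h s j hs hdet
  exact integrable_conj_unipDeltaChar_mul_of_presentation L e dV hdV dW hdW T Tinv Fr hFr hT2 hTU hT1 hTiv hTN
    (νinf (kindWFinset L e dV hdV dW hdW T₀ (S : Matrix (Fin 2) (Fin 2) L) h)) B C hBC k Q
    (UnitaryGroup.archPart (Fp L) L (IsCMField.complexConj L) (2 + 2) (hermD L e dV hdV dW hdW) h) (S : Matrix (Fin 2) (Fin 2) L) hs' Fs hFs hFsQ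
    (FinfT j S h s) hpr

end Summit.HodgeConjecture.HodgeConjecture.Cruxes.HLiu418.K2LiuKindWArchLetterIntegrable

end
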